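import Literature.Probability.Percolation.ConditionalGladkovZimin
import Literature.Probability.Percolation.GladkovZiminThreeCopy
import HarnessLib

/-!
# Conditional Gladkov–Zimin inequalities of degree three: the three-copy kernel inequality (GZ Thm 5.1, `k = 3`)
# for the terminal-pattern law of bond percolation CONDITIONED on `{Y ↮ T}`

Topic `Literature/Probability/Percolation`.  Sequel of `ConditionalGladkovZimin.lean` (the two-copy / quadratic case, with the whole
two-cluster Gibbs-sampler machinery: `chain`, `patT_chain_mono`, `abs_smass_mul_sub_cmass_le`, `cmass`, `smass`) and of
`GladkovZiminThreeCopy.lean` (`kernel3_classMass_le`, `tripleSuper_of_pointwise`: the UNconditional three-copy inequality on a weighted cube).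

Gladkov–Zimin [GladkovZimin2024HK, §3.2] observe that the Bernoulli percolation measure conditioned on a disconnection `{S ↮ T}` is approximated
by "a sequence of product measures on hypercubes of increasing dimension" on which cluster-monotone events are upward- or downward-closed (the Gibbs sampler of
van den Berg–Häggström–Kahn 2006, Remark after the proof of Thm. 2.1), so that every hypercube kernel inequality transfers to the conditional pattern
law; §5 Thm. 5.1 is their `k`-copy kernel inequality.  This file carries out the transfer for `k = 3` exactly as the companion file does for `k = 2`:

* `condKernel3_ED_le_of_lt_one`, `condKernel3_ED_le` (finite-sum forms) and
* `prodBernoulli_condPatternKernel3_le` — for `μ = prodBernoulli w`, disjoint `Y, T`, terminals in `T`, a monotone labelling `lab` of patterns and a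
  triple kernel `B` with the pointwise endpoint inequalities (`a ≤ a'`, `b ≤ b'`, `c ≤ c'`:
  `B a b c' + B a b' c + B a' b c ≤ 2 B a b c + B a' b' c'` and `B a b' c' + B a' b c' + B a' b' c ≤ B a b c + 2 B a' b' c'`):
  `Σ_{a,b,c} B a b c · m_a m_b m_c ≤ M² · Σ_a B a a a · m_a`,  `m_a = μ(lab(pat) = a, Y ↮ T)`, `M = μ(Y ↮ T)`.

Proof: GZ Thm 5.1 (`kernel3_classMass_le`) on the noise cube of the `n`-step chain, `n → ∞` by the renewal coupling, weights `1` by continuity, bridge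
`prodBernoulli_real_eq_PrW` — verbatim the degree-two argument.  Not here: `k ≥ 4`.

## References
* N. Gladkov, A. Zimin, *On Harris–Kleitman type inequalities*, unpublished draft, September 2024, §3.2 and §5 Thm. 5.1. [GladkovZimin2024HK]
* J. van den Berg, O. Häggström, J. Kahn, RSA 29 (2006), §2.1. [VandenbergHaggstromKahn2005]
-/

noncomputable section

namespace Literature.Probability.Percolation

namespace CondGZ

open Finset DecisionTree Filter Topology MeasureTheory Literature.Probability.LatticeModels
open scoped Classical

variable {V : Type*} [Fintype V] [DecidableEq V] (Y T : Finset V)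

/-- **Conditional three-copy Gladkov–Zimin (degree 3), finite-sum form, weights `< 1`.**  For a triple kernel `B` on the label preorder satisfying the pointwise
endpoint inequalities of GZ Thm 5.1 (`k = 3`; tree `tripleSuper_of_pointwise`), the conditional class masses `m_a = μ(lab(pat) = a, Y ↮ T)`, `M = μ(Y ↮ T)` obey
`Σ_{a,b,c} B a b c · m_a m_b m_c ≤ M² · Σ_a B a a a · m_a`. [cite: GladkovZimin2024HK, §5 Thm. 5.1 with §3.2] -/
theorem condKernel3_ED_le_of_lt_one (hYT : Disjoint Y T) {k : ℕ} (term : Fin k → V) (hterm : ∀ i, term i ∈ T)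
    {p : Sym2 V → ℝ} (hp0 : ∀ e, 0 ≤ p e) (hp1 : ∀ e, p e < 1)
    {κ : Type*} [Preorder κ] [DecidableEq κ] (lab : Finset (Fin k × Fin k) → κ) (hlab : ∀ ⦃a b : Finset (Fin k × Fin k)⦄, a ⊆ b → lab a ≤ lab b)
    (t : Finset κ) (ht : ∀ ω, lab (patT term ω) ∈ t) (B : κ → κ → κ → ℝ)
    (hB0 : ∀ ⦃a a' b b' c c' : κ⦄, a ≤ a' → b ≤ b' → c ≤ c' → B a b c' + B a b' c + B a' b c ≤ 2 * B a b c + B a' b' c')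
    (hB1 : ∀ ⦃a a' b b' c c' : κ⦄, a ≤ a' → b ≤ b' → c ≤ c' → B a b' c' + B a' b c' + B a' b' c ≤ B a b c + 2 * B a' b' c') :
    ∑ a ∈ t, ∑ b ∈ t, ∑ c ∈ t, B a b c * (cmass Y T term lab p a * cmass Y T term lab p b * cmass Y T term lab p c) ≤
      smass Y T p ^ 2 * ∑ a ∈ t, B a a a * cmass Y T term lab p a := by
  have hp1' : ∀ e, p e ≤ 1 := fun e => (hp1 e).le
  set M := smass Y T p with hMdef
  have hM0 : 0 ≤ M := smass_nonneg Y T hp0 hp1'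
  set r : ℝ := 1 - wtW Finset.univ p ∅ with hr
  have hc_pos : 0 < wtW (Finset.univ : Finset (Sym2 V)) p ∅ := by
    rw [wtW_univ_empty]; exact Finset.prod_pos fun e _ => sub_pos.2 (hp1 e)
  have hc_le : wtW (Finset.univ : Finset (Sym2 V)) p ∅ ≤ 1 := by
    rw [wtW_univ_empty]; exact Finset.prod_le_one (fun e _ => sub_nonneg.2 (hp1' e)) fun e _ => sub_le_self _ (hp0 e)
  have hr0 : 0 ≤ r := sub_nonneg.2 hc_le
  have hr1 : r < 1 := by rw [hr]; linarith
  set x : ℕ → κ → ℝ := fun n a => M * ED (cube n) (noiseWt p) (fun X => if lab (patT term (chain Y T ∅ n X)) = a then (1 : ℝ) else 0) with hx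
  have hGZ : ∀ n, ∑ a ∈ t, ∑ b ∈ t, ∑ c ∈ t, B a b c * (x n a * x n b * x n c) ≤ M ^ 2 * ∑ a ∈ t, B a a a * x n a := by
    intro n
    have hπ : ∀ ⦃X X' : Finset (NoiseCoord V)⦄, X ⊆ X' → lab (patT term (chain Y T ∅ n X)) ≤ lab (patT term (chain Y T ∅ n X')) :=
      fun X X' h => hlab (patT_chain_mono Y T hterm (isSep_empty Y T hYT) n h)
    have h := kernel3_classMass_le (cube n) (noiseWt_nonneg hp0 hp1') (noiseWt_le_one hp0 hp1') (fun X => lab (patT term (chain Y T ∅ n X))) hπ t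
      (fun X _ => ht _) B (tripleSuper_of_pointwise B hB0 hB1)
    simp only [classMass_eq_ED] at h
    set cm : κ → ℝ := fun a => ED (cube n) (noiseWt p) (fun X => if lab (patT term (chain Y T ∅ n X)) = a then (1 : ℝ) else 0) with hcm
    have hx' : ∀ a, x n a = M * cm a := fun a => rfl
    have h' : ∑ a ∈ t, ∑ b ∈ t, ∑ c ∈ t, B a b c * (cm a * cm b * cm c) ≤ ∑ a ∈ t, B a a a * cm a := h
    calc ∑ a ∈ t, ∑ b ∈ t, ∑ c ∈ t, B a b c * (x n a * x n b * x n c)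
        = M ^ 3 * ∑ a ∈ t, ∑ b ∈ t, ∑ c ∈ t, B a b c * (cm a * cm b * cm c) := by
          rw [Finset.mul_sum]; refine Finset.sum_congr rfl fun a _ => ?_
          rw [Finset.mul_sum]; refine Finset.sum_congr rfl fun b _ => ?_
          rw [Finset.mul_sum]; refine Finset.sum_congr rfl fun c _ => ?_
          rw [hx', hx', hx']; ring
      _ ≤ M ^ 3 * ∑ a ∈ t, B a a a * cm a := mul_le_mul_of_nonneg_left h' (pow_nonneg hM0 3)
      _ = M ^ 2 * ∑ a ∈ t, B a a a * x n a := by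
          rw [Finset.mul_sum, Finset.mul_sum]; refine Finset.sum_congr rfl fun a _ => ?_
          rw [hx']; ring
  have hconv : ∀ a, Tendsto (fun n => x n a) atTop (𝓝 (cmass Y T term lab p a)) := by
    intro a
    have h0 : Tendsto (fun n => M * r ^ n) atTop (𝓝 0) := by
      simpa using (tendsto_pow_atTop_nhds_zero_of_lt_one hr0 hr1).const_mul M
    have h1 : Tendsto (fun n => x n a - cmass Y T term lab p a) atTop (𝓝 0) :=
      squeeze_zero_norm (fun n => by simpa [Real.norm_eq_abs] using abs_smass_mul_sub_cmass_le Y T hYT term lab hp0 hp1' a n) h0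
    exact tendsto_sub_nhds_zero_iff.1 h1
  have hlim : Tendsto (fun n => ∑ a ∈ t, ∑ b ∈ t, ∑ c ∈ t, B a b c * (x n a * x n b * x n c) - M ^ 2 * ∑ a ∈ t, B a a a * x n a) atTop
      (𝓝 (∑ a ∈ t, ∑ b ∈ t, ∑ c ∈ t, B a b c * (cmass Y T term lab p a * cmass Y T term lab p b * cmass Y T term lab p c) -
        M ^ 2 * ∑ a ∈ t, B a a a * cmass Y T term lab p a)) := by
    refine Tendsto.sub ?_ ?_
    · exact tendsto_finsetSum _ fun a _ => tendsto_finsetSum _ fun b _ => tendsto_finsetSum _ fun c _ =>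
        (((hconv a).mul (hconv b)).mul (hconv c)).const_mul _
    · exact (tendsto_finsetSum _ fun a _ => (hconv a).const_mul _).const_mul _
  have hle : ∀ n, ∑ a ∈ t, ∑ b ∈ t, ∑ c ∈ t, B a b c * (x n a * x n b * x n c) - M ^ 2 * ∑ a ∈ t, B a a a * x n a ≤ 0 :=
    fun n => sub_nonpos.2 (hGZ n)
  exact sub_nonpos.1 (le_of_tendsto' hlim hle)

/-- **Conditional three-copy Gladkov–Zimin, finite-sum form** (all weights in `[0,1]`, by continuity along `s ↦ s • p`). [cite: GladkovZimin2024HK, §5 Thm. 5.1 with §3.2] -/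
theorem condKernel3_ED_le (hYT : Disjoint Y T) {k : ℕ} (term : Fin k → V) (hterm : ∀ i, term i ∈ T)
    {p : Sym2 V → ℝ} (hp0 : ∀ e, 0 ≤ p e) (hp1 : ∀ e, p e ≤ 1)
    {κ : Type*} [Preorder κ] [DecidableEq κ] (lab : Finset (Fin k × Fin k) → κ) (hlab : ∀ ⦃a b : Finset (Fin k × Fin k)⦄, a ⊆ b → lab a ≤ lab b)
    (t : Finset κ) (ht : ∀ ω, lab (patT term ω) ∈ t) (B : κ → κ → κ → ℝ)
    (hB0 : ∀ ⦃a a' b b' c c' : κ⦄, a ≤ a' → b ≤ b' → c ≤ c' → B a b c' + B a b' c + B a' b c ≤ 2 * B a b c + B a' b' c')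
    (hB1 : ∀ ⦃a a' b b' c c' : κ⦄, a ≤ a' → b ≤ b' → c ≤ c' → B a b' c' + B a' b c' + B a' b' c ≤ B a b c + 2 * B a' b' c') :
    ∑ a ∈ t, ∑ b ∈ t, ∑ c ∈ t, B a b c * (cmass Y T term lab p a * cmass Y T term lab p b * cmass Y T term lab p c) ≤
      smass Y T p ^ 2 * ∑ a ∈ t, B a a a * cmass Y T term lab p a := by
  set F : ℝ → ℝ := fun s => ∑ a ∈ t, ∑ b ∈ t, ∑ c ∈ t, B a b c * (cmass Y T term lab (fun e => s * p e) a *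
      cmass Y T term lab (fun e => s * p e) b * cmass Y T term lab (fun e => s * p e) c) -
      smass Y T (fun e => s * p e) ^ 2 * ∑ a ∈ t, B a a a * cmass Y T term lab (fun e => s * p e) a with hF
  have hFc : Continuous F := by
    have hc : ∀ a, Continuous fun s : ℝ => cmass Y T term lab (fun e => s * p e) a := fun a => continuous_ED_ray _ p _
    have hs : Continuous fun s : ℝ => smass Y T (fun e => s * p e) := continuous_ED_ray _ p _
    refine Continuous.sub ?_ ?_
    · exact continuous_finsetSum _ fun a _ => continuous_finsetSum _ fun b _ => continuous_finsetSum _ fun c _ =>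
        continuous_const.mul (((hc a).mul (hc b)).mul (hc c))
    · exact (hs.pow 2).mul (continuous_finsetSum _ fun a _ => continuous_const.mul (hc a))
  have hFle : ∀ s : ℝ, 0 ≤ s → s < 1 → F s ≤ 0 := by
    intro s hs0 hs1
    have hq0 : ∀ e, 0 ≤ s * p e := fun e => mul_nonneg hs0 (hp0 e)
    have hq1 : ∀ e, s * p e < 1 := fun e => lt_of_le_of_lt (mul_le_of_le_one_right hs0 (hp1 e)) hs1
    exact sub_nonpos.2 (condKernel3_ED_le_of_lt_one Y T hYT term hterm hq0 hq1 lab hlab t ht B hB0 hB1)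
  have hseq : Tendsto (fun j : ℕ => (1 : ℝ) - 1 / ((j : ℝ) + 1)) atTop (𝓝 1) := by
    simpa using (tendsto_one_div_add_atTop_nhds_zero_nat.const_sub (1 : ℝ))
  have hlim : Tendsto (fun j : ℕ => F (1 - 1 / ((j : ℝ) + 1))) atTop (𝓝 (F 1)) := (hFc.tendsto 1).comp hseq
  have hle : ∀ j : ℕ, F (1 - 1 / ((j : ℝ) + 1)) ≤ 0 := by
    intro j
    have hj : (0 : ℝ) < (j : ℝ) + 1 := by positivity
    refine hFle _ ?_ ?_
    · rw [sub_nonneg, div_le_one hj]; linarith [(Nat.cast_nonneg j : (0 : ℝ) ≤ j)]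
    · have : 0 < 1 / ((j : ℝ) + 1) := by positivity
      linarith
  have h1 : F 1 ≤ 0 := le_of_tendsto' hlim hle
  have hp : (fun e => (1 : ℝ) * p e) = p := funext fun e => one_mul (p e)
  simp only [hF, hp] at h1
  exact sub_nonpos.1 h1

/-- **Conditional three-copy Gladkov–Zimin inequality for bond percolation** (degree 3; GZ Thm 5.1 `k = 3` transported to the pattern law conditioned on
`{Y ↮ T}` exactly as the two-copy Thm 2.3 is in `prodBernoulli_condPatternKernel_le`): with `m_a = μ(lab(pat) = a, Y ↮ T)`, `M = μ(Y ↮ T)` and a triple kernel `B`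
satisfying the pointwise endpoint inequalities, `Σ_{a,b,c} B a b c · m_a m_b m_c ≤ M² · Σ_a B a a a · m_a`. [cite: GladkovZimin2024HK, §5 Thm. 5.1 with §3.2] -/
theorem prodBernoulli_condPatternKernel3_le (w : Sym2 V → unitInterval) (hYT : Disjoint Y T) {k : ℕ} (term : Fin k → V)
    (hterm : ∀ i, term i ∈ T) {κ : Type*} [Preorder κ] [DecidableEq κ] (lab : Finset (Fin k × Fin k) → κ)
    (hlab : ∀ ⦃a b : Finset (Fin k × Fin k)⦄, a ⊆ b → lab a ≤ lab b) (t : Finset κ) (ht : ∀ ω : Set (Sym2 V), lab (pat term ω) ∈ t)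
    (B : κ → κ → κ → ℝ)
    (hB0 : ∀ ⦃a a' b b' c c' : κ⦄, a ≤ a' → b ≤ b' → c ≤ c' → B a b c' + B a b' c + B a' b c ≤ 2 * B a b c + B a' b' c')
    (hB1 : ∀ ⦃a a' b b' c c' : κ⦄, a ≤ a' → b ≤ b' → c ≤ c' → B a b' c' + B a' b c' + B a' b' c ≤ B a b c + 2 * B a' b' c') :
    ∑ a ∈ t, ∑ b ∈ t, ∑ c ∈ t, B a b c *
        ((prodBernoulli w).real {ω : Set (Sym2 V) | (∀ y ∈ Y, ∀ x ∈ T, ¬ (openGraph ω).Reachable y x) ∧ lab (pat term ω) = a} *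
          (prodBernoulli w).real {ω : Set (Sym2 V) | (∀ y ∈ Y, ∀ x ∈ T, ¬ (openGraph ω).Reachable y x) ∧ lab (pat term ω) = b} *
          (prodBernoulli w).real {ω : Set (Sym2 V) | (∀ y ∈ Y, ∀ x ∈ T, ¬ (openGraph ω).Reachable y x) ∧ lab (pat term ω) = c}) ≤
      (prodBernoulli w).real {ω : Set (Sym2 V) | ∀ y ∈ Y, ∀ x ∈ T, ¬ (openGraph ω).Reachable y x} ^ 2 *
        ∑ a ∈ t, B a a a * (prodBernoulli w).real {ω : Set (Sym2 V) | (∀ y ∈ Y, ∀ x ∈ T, ¬ (openGraph ω).Reachable y x) ∧ lab (pat term ω) = a} := by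
  set p : Sym2 V → ℝ := fun e => (w e : ℝ) with hp
  have hp0 : ∀ e, 0 ≤ p e := fun e => (w e).2.1
  have hp1 : ∀ e, p e ≤ 1 := fun e => (w e).2.2
  have hm : ∀ a : κ, (prodBernoulli w).real {ω : Set (Sym2 V) | (∀ y ∈ Y, ∀ x ∈ T, ¬ (openGraph ω).Reachable y x) ∧ lab (pat term ω) = a} =
      cmass Y T term lab p a := by
    intro a
    rw [DecisionTree.prodBernoulli_real_eq_PrW w (determinedBy_univ _)
      (X := {S : Finset (Sym2 V) | IsSep Y T S ∧ lab (patT term S) = a}) (fun S _ => Iff.rfl), PrW_univ_eq_ED]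
    unfold cmass
    refine ED_congr_on _ _ fun S _ => ?_
    by_cases h1 : IsSep Y T S
    · by_cases h2 : lab (patT term S) = a
      · rw [sepInd, if_pos h1, if_pos h2, if_pos (show S ∈ {S : Finset (Sym2 V) | IsSep Y T S ∧ lab (patT term S) = a} from ⟨h1, h2⟩)]; ring
      · rw [sepInd, if_pos h1, if_neg h2, if_neg (fun h : S ∈ {S : Finset (Sym2 V) | IsSep Y T S ∧ lab (patT term S) = a} => h2 h.2)]; ring
    · rw [sepInd, if_neg h1, if_neg (fun h : S ∈ {S : Finset (Sym2 V) | IsSep Y T S ∧ lab (patT term S) = a} => h1 h.1)]; ring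
  have hM : (prodBernoulli w).real {ω : Set (Sym2 V) | ∀ y ∈ Y, ∀ x ∈ T, ¬ (openGraph ω).Reachable y x} = smass Y T p := by
    rw [DecisionTree.prodBernoulli_real_eq_PrW w (determinedBy_univ _) (X := {S : Finset (Sym2 V) | IsSep Y T S}) (fun S _ => Iff.rfl),
      PrW_univ_eq_ED]
    rfl
  simp only [hm, hM]
  exact condKernel3_ED_le Y T hYT term hterm hp0 hp1 lab hlab t (fun S => ht _) B hB0 hB1

end CondGZ

end Literature.Probability.Percolation
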